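import Mathlib

/-!
# Route HardyPointSink — crux `NoHardyTypeIAncient` (stmt-NavierStokesRegularity-7980):
# certificate for the crux idea `exposed-halfspace` — a locally discretely self-similar blow-up is
# parabolically quiet beyond every supporting plane at an exposed singular point

Summit-side proof file (lead c3; certificate of claim (a) of the crux idea card
`Cruxes/NoHardyTypeIAncient/Ideas/exposed-halfspace.md`). The statement is elementary real analysis,
kept free of every PDE notion so that it applies verbatim to the route's frame:

Let `u : ℝ → ℝ³ → ℝ³`, a time `T`, a centre `xs`, a radius `r₀ > 0` and a factor `λ > 1` be such that
`u` is **λ-discretely self-similar about `(xs, T)` on `B(xs, r₀) × (T − r₀², T)`**: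
`u(T − s/λ^{2j}, xs + λ^{-j} y) = λ^{j} u(T − s, xs + y)` for `‖y‖ ≤ r₀`, `0 < s < r₀²`, `j ∈ ℕ`.
Let `e` be a unit vector such that every point `xs + q` of the CLOSED half-annulus
`K = {r₀/λ ≤ ‖q‖ ≤ r₀, ⟪q, e⟫ ≥ 0}` is a regular point of `(u, T)` in the weakest sense — `u` is
bounded on some backward parabolic neighbourhood of `(xs + q, T)` (this is what exposedness of `xs` in
the compact final-time singular set gives, when `xs` is the unique contact point with the supporting
plane `⟪x − xs, e⟫ = 0`). THEN for every threshold `θ > 0` there is `M` with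
`‖u(t, x)‖² (T − t) < θ` whenever `t < T`, `‖x − xs‖ ≤ r₀` and `⟪x − xs, e⟫ > M √(T − t)`:
the activity beyond the plane is confined to the parabola `⟪x − xs, e⟫ ≤ M√(T − t)` (condition GOOD
of the card), so the half-space rigidity S-G of the card kills every locally (D)SS scenario —
including the direction-dense hierarchical lattice-DSS enemy of lines `birth` / `blowdown-cone` — at
its exposed points. Proof: compactness of `K` makes the local bounds uniform (`C`, depth `δ`); DSS
covariance transports them to every shell `r₀ λ^{-j-1} ≤ ‖x − xs‖ ≤ r₀ λ^{-j}` as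
`‖u(t,x)‖ ≤ λ^{j} C` for `T − t < λ^{-2j} δ`; and `⟪x − xs, e⟫ > M√(T − t)` forces
`λ^{2j}(T − t) < r₀²/M²`, whence `‖u‖²(T − t) ≤ C² r₀²/M² < θ` for `M` large.

## References

* Crux idea card `exposed-halfspace` (this crux's `Ideas/` directory), claim (a).
* L. Escauriaza, G. Seregin, V. Šverák, Russ. Math. Surveys 58 (2003), Thm 5.1 (the half-space
  backward uniqueness the card feeds with this confinement; tree theorem `ConeBU.halfspace`).
-/

noncomputable section

set_option linter.dupNamespace false

open Set Filter Metric
open scoped InnerProductSpace Topology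

namespace Summit.NavierStokesRegularity.NavierStokesRegularity.Theorems

/-- **Local bounds are uniform on compact sets** (backward-parabolic version): if every point `q`
of a compact `K ⊆ ℝ³` has a radius `ρ > 0` and a constant `C` with `F t y ≤ C` for `‖y − q‖ < ρ`,
`T − ρ² < t < T`, then one depth `δ > 0` and one constant `C` serve all of `K`
(`IsCompact.induction_on`). [folklore] -/
theorem hardyPointSink_uniform_bound_of_local_bound
    {K : Set (EuclideanSpace ℝ (Fin 3))} (hK : IsCompact K)
    {F : ℝ → EuclideanSpace ℝ (Fin 3) → ℝ} {T : ℝ}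
    (hloc : ∀ q ∈ K, ∃ ρ > 0, ∃ C : ℝ, ∀ (y : EuclideanSpace ℝ (Fin 3)) (t : ℝ),
      ‖y - q‖ < ρ → T - ρ ^ 2 < t → t < T → F t y ≤ C) :
    ∃ δ > 0, ∃ C : ℝ, ∀ q ∈ K, ∀ t : ℝ, T - δ < t → t < T → F t q ≤ C := by
  refine hK.induction_on (p := fun A => ∃ δ > 0, ∃ C : ℝ, ∀ q ∈ A, ∀ t : ℝ,
      T - δ < t → t < T → F t q ≤ C) ?_ ?_ ?_ ?_
  · exact ⟨1, one_pos, 0, fun q hq => (Set.notMem_empty q hq).elim⟩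
  · rintro A B hAB ⟨δ, hδ, C, hC⟩
    exact ⟨δ, hδ, C, fun q hq t h1 h2 => hC q (hAB hq) t h1 h2⟩
  · rintro A B ⟨δ₁, hδ₁, C₁, hC₁⟩ ⟨δ₂, hδ₂, C₂, hC₂⟩
    refine ⟨min δ₁ δ₂, lt_min hδ₁ hδ₂, max C₁ C₂, fun q hq t h1 h2 => ?_⟩
    rcases hq with hq | hq
    · exact (hC₁ q hq t (by linarith [min_le_left δ₁ δ₂]) h2).trans (le_max_left _ _)
    · exact (hC₂ q hq t (by linarith [min_le_right δ₁ δ₂]) h2).trans (le_max_right _ _)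
  · intro q hq
    obtain ⟨ρ, hρ, C, hC⟩ := hloc q hq
    refine ⟨ball q ρ, mem_nhdsWithin_of_mem_nhds (ball_mem_nhds q hρ), ρ ^ 2, by positivity, C,
      fun y hy t h1 h2 => hC y t (mem_ball_iff_norm.1 hy) h1 h2⟩

/-- **A locally discretely self-similar blow-up is parabolically quiet beyond every supporting plane
at an exposed singular point** (certificate of claim (a) of the crux idea `exposed-halfspace`). If
`u` is `λ`-DSS about `(xs, T)` on `B(xs, r₀) × (T − r₀², T)` (`λ > 1`), `e` is a unit vector, and
`u` is bounded on a backward parabolic neighbourhood of `(xs + q, T)` for every `q` in the closed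
half-annulus `r₀/λ ≤ ‖q‖ ≤ r₀`, `⟪q, e⟫ ≥ 0` (the final-time regular points that exposedness of
`xs` supplies), then for every `θ > 0` there is `M` such that `‖u t x‖² (T − t) < θ` whenever
`t < T`, `‖x − xs‖ ≤ r₀` and `⟪x − xs, e⟫ > M √(T − t)`. [folklore] -/
theorem hardyPointSink_exposedDSS_parabolicConfinement
    (u : ℝ → EuclideanSpace ℝ (Fin 3) → EuclideanSpace ℝ (Fin 3)) (T r₀ lam : ℝ)
    (xs e : EuclideanSpace ℝ (Fin 3)) (hr₀ : 0 < r₀) (hlam : 1 < lam) (he : ‖e‖ = 1)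
    (hcov : ∀ (j : ℕ) (y : EuclideanSpace ℝ (Fin 3)) (s : ℝ), ‖y‖ ≤ r₀ → 0 < s → s < r₀ ^ 2 →
      u (T - s / lam ^ (2 * j)) (xs + (lam ^ j)⁻¹ • y) = lam ^ j • u (T - s) (xs + y))
    (hreg : ∀ q : EuclideanSpace ℝ (Fin 3), r₀ / lam ≤ ‖q‖ → ‖q‖ ≤ r₀ → 0 ≤ ⟪q, e⟫_ℝ →
      ∃ ρ > 0, ∃ C : ℝ, ∀ (y : EuclideanSpace ℝ (Fin 3)) (t : ℝ), ‖y - q‖ < ρ →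
        T - ρ ^ 2 < t → t < T → ‖u t (xs + y)‖ ≤ C) :
    ∀ θ : ℝ, 0 < θ → ∃ M : ℝ, ∀ (t : ℝ) (x : EuclideanSpace ℝ (Fin 3)), t < T → ‖x - xs‖ ≤ r₀ →
      M * Real.sqrt (T - t) < ⟪x - xs, e⟫_ℝ → ‖u t x‖ ^ 2 * (T - t) < θ := by
  intro θ hθ
  have hlam0 : 0 < lam := lt_trans one_pos hlam
  -- the compact half-annulus of regular points
  set K : Set (EuclideanSpace ℝ (Fin 3)) :=
    {q | r₀ / lam ≤ ‖q‖ ∧ ‖q‖ ≤ r₀ ∧ 0 ≤ ⟪q, e⟫_ℝ} with hKdef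
  have hKc : IsCompact K := by
    have hc3 : Continuous fun q : EuclideanSpace ℝ (Fin 3) => ⟪q, e⟫_ℝ :=
      Continuous.inner continuous_id continuous_const
    have h1 : IsClosed {q : EuclideanSpace ℝ (Fin 3) | r₀ / lam ≤ ‖q‖} :=
      isClosed_le continuous_const continuous_norm
    have h2 : IsClosed {q : EuclideanSpace ℝ (Fin 3) | ‖q‖ ≤ r₀} :=
      isClosed_le continuous_norm continuous_const
    have h3 : IsClosed {q : EuclideanSpace ℝ (Fin 3) | 0 ≤ ⟪q, e⟫_ℝ} :=
      isClosed_le continuous_const hc3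
    have hKeq : K = {q : EuclideanSpace ℝ (Fin 3) | r₀ / lam ≤ ‖q‖} ∩
        ({q : EuclideanSpace ℝ (Fin 3) | ‖q‖ ≤ r₀} ∩ {q : EuclideanSpace ℝ (Fin 3) | 0 ≤ ⟪q, e⟫_ℝ}) := by
      ext q; simp [hKdef]
    refine Metric.isCompact_of_isClosed_isBounded ?_ ?_
    · rw [hKeq]; exact h1.inter (h2.inter h3)
    · refine (isBounded_closedBall (x := (0 : EuclideanSpace ℝ (Fin 3))) (r := r₀)).subset ?_
      intro q hq
      simpa [mem_closedBall, dist_zero_right] using hq.2.1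
  -- uniform bound on `K × (T - δ, T)`
  obtain ⟨δ, hδ, C₀, hC₀⟩ := hardyPointSink_uniform_bound_of_local_bound hKc
    (F := fun t y => ‖u t (xs + y)‖) (T := T)
    (fun q hq => hreg q hq.1 hq.2.1 hq.2.2)
  set C : ℝ := max C₀ 0 with hCdef
  have hC0 : 0 ≤ C := le_max_right _ _
  have hCK : ∀ q ∈ K, ∀ t : ℝ, T - δ < t → t < T → ‖u t (xs + q)‖ ≤ C :=
    fun q hq t h1 h2 => (hC₀ q hq t h1 h2).trans (le_max_left _ _)
  -- the constant `M`
  set M : ℝ := r₀ / Real.sqrt δ + r₀ * C / Real.sqrt θ + 1 with hMdef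
  have hsδ : 0 < Real.sqrt δ := Real.sqrt_pos.2 hδ
  have hsθ : 0 < Real.sqrt θ := Real.sqrt_pos.2 hθ
  have hM1 : r₀ / Real.sqrt δ < M := by
    have : 0 ≤ r₀ * C / Real.sqrt θ := by positivity
    linarith
  have hM2 : r₀ * C / Real.sqrt θ < M := by
    have : 0 ≤ r₀ / Real.sqrt δ := by positivity
    linarith
  have hM0 : 0 < M := by
    have h1 : 0 ≤ r₀ / Real.sqrt δ := by positivity
    have h2 : 0 ≤ r₀ * C / Real.sqrt θ := by positivity
    linarith
  have hMge1 : 1 ≤ M := by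
    have h1 : 0 ≤ r₀ / Real.sqrt δ := by positivity
    have h2 : 0 ≤ r₀ * C / Real.sqrt θ := by positivity
    linarith
  refine ⟨M, fun t x ht hxr hpar => ?_⟩
  -- geometry of the point
  set d : ℝ := ‖x - xs‖ with hddef
  have hTt : 0 < T - t := sub_pos.2 ht
  have hsq : 0 < Real.sqrt (T - t) := Real.sqrt_pos.2 hTt
  have hinner_le : ⟪x - xs, e⟫_ℝ ≤ d := by
    calc ⟪x - xs, e⟫_ℝ ≤ ‖x - xs‖ * ‖e‖ := real_inner_le_norm _ _
      _ = d := by rw [he, mul_one]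
  have hMd : M * Real.sqrt (T - t) < d := lt_of_lt_of_le hpar hinner_le
  have hd0 : 0 < d := lt_trans (mul_pos hM0 hsq) hMd
  have hinner0 : 0 < ⟪x - xs, e⟫_ℝ := lt_trans (mul_pos hM0 hsq) hpar
  -- `T - t < d² / M²`
  have hTt_lt : T - t < d ^ 2 / M ^ 2 := by
    have h1 : Real.sqrt (T - t) < d / M := by
      rw [lt_div_iff₀ hM0]; linarith
    have h2 : Real.sqrt (T - t) ^ 2 < (d / M) ^ 2 := by
      exact pow_lt_pow_left₀ h1 hsq.le two_ne_zero
    rw [Real.sq_sqrt hTt.le] at h2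
    simpa [div_pow] using h2
  -- the shell index: `lam ^ j ≤ r₀ / d < lam ^ (j + 1)`
  have hrd : 1 ≤ r₀ / d := by rw [le_div_iff₀ hd0]; linarith
  obtain ⟨j, hj1, hj2⟩ := exists_nat_pow_near hrd hlam
  have hlamj : 0 < lam ^ j := pow_pos hlam0 j
  -- `q := lam^j (x - xs)` lies in `K`
  set q : EuclideanSpace ℝ (Fin 3) := lam ^ j • (x - xs) with hqdef
  have hnq : ‖q‖ = lam ^ j * d := by
    rw [hqdef, norm_smul, Real.norm_of_nonneg hlamj.le]
  have hqK : q ∈ K := by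
    refine ⟨?_, ?_, ?_⟩
    · -- `r₀ / lam ≤ lam^j d` from `r₀ / d < lam^(j+1)`
      rw [hnq, div_le_iff₀ hlam0]
      have : r₀ < lam ^ (j + 1) * d := by rwa [div_lt_iff₀ hd0] at hj2
      rw [pow_succ] at this
      nlinarith
    · rw [hnq]
      have : lam ^ j * d ≤ r₀ / d * d := mul_le_mul_of_nonneg_right hj1 hd0.le
      rwa [div_mul_cancel₀ _ hd0.ne'] at this
    · rw [hqdef, inner_smul_left]
      simp only [conj_trivial]
      exact mul_nonneg hlamj.le hinner0.le
  -- the rescaled depth `s := lam^(2j) (T - t)` is `< δ` and `< r₀²`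
  set s : ℝ := lam ^ (2 * j) * (T - t) with hsdef
  have hlam2j : lam ^ (2 * j) = (lam ^ j) ^ 2 := by rw [mul_comm, pow_mul]
  have hs0 : 0 < s := mul_pos (pow_pos hlam0 _) hTt
  have hs_lt : s < r₀ ^ 2 / M ^ 2 := by
    have h1 : (lam ^ j) ^ 2 ≤ (r₀ / d) ^ 2 := pow_le_pow_left₀ hlamj.le hj1 2
    calc s = (lam ^ j) ^ 2 * (T - t) := by rw [hsdef, hlam2j]
      _ ≤ (r₀ / d) ^ 2 * (T - t) := mul_le_mul_of_nonneg_right h1 hTt.le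
      _ < (r₀ / d) ^ 2 * (d ^ 2 / M ^ 2) := by
          refine mul_lt_mul_of_pos_left hTt_lt ?_
          positivity
      _ = r₀ ^ 2 / M ^ 2 := by field_simp
  have hsδ' : s < δ := by
    have h1 : r₀ ^ 2 / M ^ 2 < δ := by
      -- from `r₀ / √δ < M`
      have h2 : r₀ < M * Real.sqrt δ := by rwa [div_lt_iff₀ hsδ] at hM1
      have h3 : r₀ ^ 2 < (M * Real.sqrt δ) ^ 2 := pow_lt_pow_left₀ h2 hr₀.le two_ne_zero
      rw [mul_pow, Real.sq_sqrt hδ.le] at h3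
      rw [div_lt_iff₀ (by positivity)]
      linarith
    exact hs_lt.trans h1
  have hsr : s < r₀ ^ 2 := by
    have h1 : r₀ ^ 2 / M ^ 2 ≤ r₀ ^ 2 := by
      rw [div_le_iff₀ (by positivity)]
      have : 1 ≤ M ^ 2 := by nlinarith
      nlinarith [sq_nonneg r₀]
    exact hs_lt.trans_le h1
  -- DSS covariance: `u t x = lam^j • u (T - s) (xs + q)`
  have hqn : ‖q‖ ≤ r₀ := hqK.2.1
  have hcov' := hcov j q s hqn hs0 hsr
  have ht_eq : T - s / lam ^ (2 * j) = t := by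
    rw [hsdef]; field_simp; ring
  have hx_eq : xs + (lam ^ j)⁻¹ • q = x := by
    rw [hqdef, smul_smul, inv_mul_cancel₀ hlamj.ne', one_smul]; abel
  rw [ht_eq, hx_eq] at hcov'
  -- the bound at the regular point `(xs + q, T - s)`
  have hbd : ‖u (T - s) (xs + q)‖ ≤ C := hCK q hqK (T - s) (by linarith) (by linarith)
  have hux : ‖u t x‖ ≤ lam ^ j * C := by
    rw [hcov', norm_smul, Real.norm_of_nonneg hlamj.le]
    exact mul_le_mul_of_nonneg_left hbd hlamj.le
  -- conclude
  have hux2 : ‖u t x‖ ^ 2 * (T - t) ≤ C ^ 2 * s := by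
    have h1 : ‖u t x‖ ^ 2 ≤ (lam ^ j * C) ^ 2 := pow_le_pow_left₀ (norm_nonneg _) hux 2
    calc ‖u t x‖ ^ 2 * (T - t) ≤ (lam ^ j * C) ^ 2 * (T - t) :=
          mul_le_mul_of_nonneg_right h1 hTt.le
      _ = C ^ 2 * s := by rw [hsdef, hlam2j]; ring
  rcases hC0.eq_or_lt with hC | hC
  · -- `C = 0`
    have : ‖u t x‖ ^ 2 * (T - t) ≤ 0 := by simpa [← hC] using hux2
    linarith
  · have hCs : C ^ 2 * s < C ^ 2 * (r₀ ^ 2 / M ^ 2) := mul_lt_mul_of_pos_left hs_lt (by positivity)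
    have hfin : C ^ 2 * (r₀ ^ 2 / M ^ 2) < θ := by
      -- from `r₀ C / √θ < M`
      have h2 : r₀ * C < M * Real.sqrt θ := by rwa [div_lt_iff₀ hsθ] at hM2
      have h3 : (r₀ * C) ^ 2 < (M * Real.sqrt θ) ^ 2 :=
        pow_lt_pow_left₀ h2 (by positivity) two_ne_zero
      rw [mul_pow, mul_pow, Real.sq_sqrt hθ.le] at h3
      have hM2pos : 0 < M ^ 2 := by positivity
      rw [show C ^ 2 * (r₀ ^ 2 / M ^ 2) = r₀ ^ 2 * C ^ 2 / M ^ 2 by ring, div_lt_iff₀ hM2pos]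
      linarith
    linarith

end Summit.NavierStokesRegularity.NavierStokesRegularity.Theorems

namespace Summit.NavierStokesRegularity.NavierStokesRegularity.Theorems

/-- Closed form of `hardyPointSink_exposedDSS_parabolicConfinement` (all data universally
quantified; registered certificate sub-goal of the crux item for idea `exposed-halfspace`, claim (a)).
[folklore] -/
theorem hardyPointSink_exposedDSS_parabolicConfinement_closed :
    ∀ (u : ℝ → EuclideanSpace ℝ (Fin 3) → EuclideanSpace ℝ (Fin 3)) (T r₀ lam : ℝ)
      (xs e : EuclideanSpace ℝ (Fin 3)), 0 < r₀ → 1 < lam → ‖e‖ = 1 →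
      (∀ (j : ℕ) (y : EuclideanSpace ℝ (Fin 3)) (s : ℝ), ‖y‖ ≤ r₀ → 0 < s → s < r₀ ^ 2 →
        u (T - s / lam ^ (2 * j)) (xs + (lam ^ j)⁻¹ • y) = lam ^ j • u (T - s) (xs + y)) →
      (∀ q : EuclideanSpace ℝ (Fin 3), r₀ / lam ≤ ‖q‖ → ‖q‖ ≤ r₀ → 0 ≤ inner ℝ q e →
        ∃ ρ > 0, ∃ C : ℝ, ∀ (y : EuclideanSpace ℝ (Fin 3)) (t : ℝ), ‖y - q‖ < ρ →
          T - ρ ^ 2 < t → t < T → ‖u t (xs + y)‖ ≤ C) →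
      ∀ θ : ℝ, 0 < θ → ∃ M : ℝ, ∀ (t : ℝ) (x : EuclideanSpace ℝ (Fin 3)), t < T → ‖x - xs‖ ≤ r₀ →
        M * Real.sqrt (T - t) < inner ℝ (x - xs) e → ‖u t x‖ ^ 2 * (T - t) < θ :=
  fun u T r₀ lam xs e hr₀ hlam he hcov hreg =>
    hardyPointSink_exposedDSS_parabolicConfinement u T r₀ lam xs e hr₀ hlam he hcov hreg

end Summit.NavierStokesRegularity.NavierStokesRegularity.Theorems
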